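import Summits.Parity.GeneralizedHardyLittlewood.Theorems.RelativeDimOne.Negative.RelativeDimOneLoadBearing
import Literature.NumberTheory.LFunctions.RHWave0PNTProofs
import HarnessLib

/-!
# `RelativeDimOne` (stmt-Parity-14113): the pairwise clause of non-degeneracy is load-bearing — `(n, n)`

Negative lemma for the crux `LeeYangFibres.RelativeDimOne` (cdisprove seat, cycle 1), part 3
(vocabulary `Concl`, `seg` from part 1 `RelativeDimOneLoadBearing`). Part 2 shows that deleting
`IsNondegenerateSystem` is fatal via a CONSTANT form (first clause `ψ̇ᵢ ≠ 0`). Here the second clause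
(no two forms rational multiples of each other) is shown load-bearing ON ITS OWN, with honest forms:
`relativeDimOne_false_without_nonproportional` — the crux with non-degeneracy weakened to "all linear
coefficients non-zero" is FALSE. Witness `t = 2`, `Ψ = (n, n)` (`‖Ψ‖_N = 2`), `K = [1, N]`:
`S = Σ_{n ≤ N} Λ(n)² ≥ Σ_{√N < p ≤ N} (log p)² ≥ ½ log N · (ϑ(N) − ϑ(√N)) ≥ ⅜ N log N`
(`vonMangoldtSum_rep_ge`; PNT for `ϑ`, tree `Literature.NumberTheory.LFunctions.chebyshevTheta_isEquivalent`,
and Chebyshev's `ϑ(x) ≤ x log 4`, Mathlib `Chebyshev.theta_le_log4_mul_x`), while the main term is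
`(N − 1)·c` with `c = 𝔖(n, n)` an UNSPECIFIED real number (the partial products `∏_{p≤x} p/(p−1)` diverge and
`singularProduct` is a `limUnder`): at `ε = 1` the conclusion forces `⅜ log N ≤ 2|c| + 1`, false once
`log N > 8|c| + 4` — for every value of `c`. Remark (not formalised): proportional pairs of ratio `≠ 1`
are harmless for this statement (ratio `−1` empties the positivity region, `S = β_∞ = 0`; any other
ratio puts a local obstruction, `𝔖 = 0`, and leaves `O(log N)` prime-power points), so "no form
repeated" is the exact content of the clause. Addendum §B3 (contrast to the false `L`-uniformity of
part 2): `N₀` uniform in `t` is AUTOMATIC — `‖Ψ‖_N ≥ t` for non-degenerate systems (`card_le_affLinSize`),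
so only `t ≤ L` is inhabited and `relativeDimOneUniformInT_iff : RelativeDimOneUniformInT ↔ RelativeDimOne`.
[folklore]
-/

noncomputable section

open scoped BigOperators Classical Topology
open Finset Filter MeasureTheory Set Literature.NumberTheory.Sieve
open Summit.Parity.GeneralizedHardyLittlewood.Theses.LeeYangFibres (RelativeDimOne DimOne)

namespace Summit.Parity.GeneralizedHardyLittlewood.Theorems.RelativeDimOne.Negative

/-! ## §D The second clause of non-degeneracy: the REPEATED form `(n, n)`

Deleting only the pairwise clause of `IsNondegenerateSystem` (keeping `ψ̇ᵢ ≠ 0`) is already fatal: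
for `Ψ = (n, n)` the sum is `Σ_{n ≤ N} Λ(n)² ≍ N log N`, super-linear, while the main term is
`β_∞ · 𝔖(Ψ)` with `𝔖(Ψ)` SOME real number (the partial products `∏_{p ≤ x} p/(p−1)` diverge, so
`limUnder` returns an unspecified value) — whatever that value `c` is, `|S − (N−1)c| ≤ (N−1)c + N`
fails once `log N > 8|c| + 4`. (Proportional pairs with ratio `≠ 1` are harmless: ratio `−1` empties the
positivity region, any other ratio creates a local obstruction and leaves `O(log N)` prime-power points;
so "no form repeated" is the exact content of the clause for this statement.) Prime input: the prime
number theorem for `ϑ` (tree `chebyshevTheta_isEquivalent`) and Chebyshev's bound `ϑ(x) ≤ x log 4`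
(Mathlib) — used only through `ϑ(N) − ϑ(√N) ≥ ¾ N`.
-/

/-- The repeated-form system `(n, n)` (`t = 2`): coefficients non-zero, NOT non-degenerate. -/
def rep : Fin 2 → AffLinForm 1 := fun _ => ⟨fun _ => 1, 0⟩

/-- `ψᵢ(n) = n₀` for both forms. -/
theorem rep_eval (i : Fin 2) (n : Fin 1 → ℤ) : (rep i).eval n = n 0 := by
  simp [rep, AffLinForm.eval]

/-- `ψᵢ(x) = x₀` on `ℝ¹`. -/
theorem rep_realEval (i : Fin 2) (x : Fin 1 → ℝ) : (rep i).realEval x = x 0 := by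
  simp [rep, AffLinForm.realEval]

/-- The linear coefficients of `(n, n)` are non-zero (first clause of non-degeneracy holds). -/
theorem rep_coeff_ne_zero (i : Fin 2) : (rep i).coeff ≠ 0 := fun h => by
  simpa [rep] using congr_fun h 0

/-- `(n, n)` violates the second clause of non-degeneracy (`1·ψ₀ = 1·ψ₁`). -/
theorem not_isNondegenerateSystem_rep : ¬ IsNondegenerateSystem rep := by
  intro h
  have := (h.2 0 1 (by decide) 1 1 fun n => rfl).1
  exact one_ne_zero this

/-- `‖(n, n)‖_N = 2`. -/
theorem affLinSize_rep (N : ℝ) : affLinSize rep N = 2 := by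
  simp [affLinSize, rep]

/-- `β_∞((n,n); [1, N]) = N − 1` for `N ≥ 1`. -/
theorem archFactor_rep_seg {N : ℕ} (hN : 1 ≤ N) : archFactor rep (seg 1 N) = N - 1 := by
  unfold archFactor
  have hN' : (1 : ℝ) ≤ N := by exact_mod_cast hN
  have hset : seg 1 N ∩ {x | ∀ i, 0 < (rep i).realEval x} = seg 1 N := by
    refine Set.inter_eq_left.mpr fun x hx i => ?_
    rw [mem_seg] at hx
    rw [rep_realEval]
    linarith [hx.1]
  rw [hset, seg, Real.volume_Icc_pi_toReal (fun _ => hN')]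
  simp

/-- The large primes `√N < p ≤ N`. -/
def bigPrimes (N : ℕ) : Finset ℕ := (Nat.primesLE N).filter (fun p => Nat.sqrt N < p)

/-- **Sub-sum bound**: `S((n,n); [1,N], N) ≥ Σ_{√N < p ≤ N} (log p)²` (drop all lattice points but the
large primes; every term is `≥ 0`). -/
theorem sum_bigPrimes_le_vonMangoldtSum_rep (N : ℕ) :
    ∑ p ∈ bigPrimes N, Real.log p ^ 2 ≤ vonMangoldtSum rep (seg 1 N) N := by
  unfold vonMangoldtSum
  set emb : ℕ → (Fin 1 → ℤ) := fun m _ => (m : ℤ) with hemb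
  have hinj : ∀ x ∈ bigPrimes N, ∀ y ∈ bigPrimes N, emb x = emb y → x = y := by
    intro x _ y _ hxy
    have := congr_fun hxy 0
    simpa [hemb] using this
  have hval : ∀ p ∈ bigPrimes N, ∏ i, intVonMangoldt ((rep i).eval (emb p)) = Real.log p ^ 2 := by
    intro p hp
    have hpP : p.Prime := (Nat.mem_primesLE.mp (Finset.mem_filter.mp hp).1).2
    simp [rep_eval, hemb, intVonMangoldt, ArithmeticFunction.vonMangoldt_apply_prime hpP, sq]
  have himg : ∑ n ∈ (bigPrimes N).image emb, ∏ i, intVonMangoldt ((rep i).eval n) =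
      ∑ p ∈ bigPrimes N, ∏ i, intVonMangoldt ((rep i).eval (emb p)) := Finset.sum_image hinj
  rw [← Finset.sum_congr rfl hval, ← himg]
  refine Finset.sum_le_sum_of_subset_of_nonneg ?_ fun n _ _ =>
    Finset.prod_nonneg fun i _ => ArithmeticFunction.vonMangoldt_nonneg
  intro n hn
  rw [Finset.mem_image] at hn
  obtain ⟨p, hp, rfl⟩ := hn
  have hp' := Nat.mem_primesLE.mp (Finset.mem_filter.mp hp).1
  have hp1 : (1 : ℝ) ≤ p := by exact_mod_cast hp'.2.one_le
  have hpN : (p : ℝ) ≤ N := by exact_mod_cast hp'.1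
  rw [Finset.mem_filter]
  refine ⟨?_, ?_⟩
  · simp only [latticeBox, Fintype.mem_piFinset, Finset.mem_Icc, hemb]
    intro i
    constructor <;> omega
  · rw [mem_seg]
    simp only [realPoint, hemb, Int.cast_natCast]
    exact ⟨hp1, hpN⟩

/-- `Σ_{√N < p ≤ N} log p = ϑ(N) − ϑ(√N)` (`√N` the integer square root). -/
theorem sum_bigPrimes_log (N : ℕ) :
    ∑ p ∈ bigPrimes N, Real.log p = Chebyshev.theta N - Chebyshev.theta (Nat.sqrt N) := by
  rw [Chebyshev.theta_eq_sum_primesLE_log, Chebyshev.theta_eq_sum_primesLE_log, bigPrimes,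
    eq_sub_iff_add_eq, ← Finset.sum_filter_add_sum_filter_not (Nat.primesLE N) (fun p => Nat.sqrt N < p)]
  congr 2
  ext p
  simp only [Finset.mem_filter, Nat.mem_primesLE, not_lt]
  constructor
  · rintro ⟨hle, hp⟩
    exact ⟨⟨hle.trans (Nat.sqrt_le_self N), hp⟩, hle⟩
  · rintro ⟨⟨-, hp⟩, hle⟩
    exact ⟨hle, hp⟩

/-- For `p > √N` (integer square root): `log N < 2 log p`. -/
theorem log_lt_two_mul_log {N p : ℕ} (hN : 1 ≤ N) (hp : Nat.sqrt N < p) :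
    Real.log N < 2 * Real.log p := by
  have h1 : N < p * p := lt_of_lt_of_le (Nat.lt_succ_sqrt N) (Nat.mul_self_le_mul_self hp)
  have h2 : (N : ℝ) < (p : ℝ) ^ 2 := by exact_mod_cast (sq p ▸ h1 : N < p ^ 2)
  have hN0 : (0 : ℝ) < N := by exact_mod_cast hN
  calc Real.log N < Real.log ((p : ℝ) ^ 2) := Real.log_lt_log hN0 h2
    _ = 2 * Real.log p := by rw [Real.log_pow]; norm_num

/-- **`S((n,n); [1,N], N) ≥ ½ log N · (ϑ(N) − ϑ(√N))`.** -/
theorem vonMangoldtSum_rep_ge {N : ℕ} (hN : 1 ≤ N) :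
    Real.log N / 2 * (Chebyshev.theta N - Chebyshev.theta (Nat.sqrt N)) ≤
      vonMangoldtSum rep (seg 1 N) N := by
  refine le_trans ?_ (sum_bigPrimes_le_vonMangoldtSum_rep N)
  rw [← sum_bigPrimes_log, Finset.mul_sum]
  refine Finset.sum_le_sum fun p hp => ?_
  have hp' := Finset.mem_filter.mp hp
  have hpP : p.Prime := (Nat.mem_primesLE.mp hp'.1).2
  have hlogp : 0 ≤ Real.log p := Real.log_nonneg (by exact_mod_cast hpP.one_le)
  have hlt := log_lt_two_mul_log hN hp'.2
  rw [sq]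
  nlinarith

/-- PNT input: for all large `N`, `ϑ(N) − ϑ(√N) ≥ ¾ N` (`ϑ(N) ≥ 0.9 N` eventually by the prime number
theorem for `ϑ`, tree `chebyshevTheta_isEquivalent`; `ϑ(√N) ≤ √N log 4 ≤ 0.14 N` for `N ≥ 100` by
Chebyshev's bound, Mathlib `Chebyshev.theta_le_log4_mul_x`). -/
theorem eventually_theta_sub_theta_sqrt_ge :
    ∃ N₁ : ℕ, ∀ N : ℕ, N₁ ≤ N →
      3 / 4 * (N : ℝ) ≤ Chebyshev.theta N - Chebyshev.theta (Nat.sqrt N) := by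
  have hθ := Literature.NumberTheory.LFunctions.chebyshevTheta_isEquivalent
  have ho := (Asymptotics.isLittleO_iff.mp hθ.isLittleO) (by norm_num : (0 : ℝ) < 1 / 10)
  obtain ⟨X, hX⟩ := Filter.eventually_atTop.mp ho
  refine ⟨max ⌈X⌉₊ 100, fun N hN => ?_⟩
  have hN100 : 100 ≤ N := le_of_max_le_right hN
  have hNX : X ≤ (N : ℝ) := (Nat.le_ceil X).trans (by exact_mod_cast le_of_max_le_left hN)
  have h1 := hX N hNX
  simp only [Pi.sub_apply, Real.norm_eq_abs] at h1
  have hN0 : (0 : ℝ) ≤ (N : ℝ) := Nat.cast_nonneg N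
  rw [abs_of_nonneg hN0] at h1
  have h1' := (abs_le.mp h1).1
  -- `ϑ(√N) ≤ log 4 · √N ≤ 1.4 · N/10`
  set M := Nat.sqrt N with hM
  have hM10 : 10 ≤ M := by
    rw [hM, Nat.le_sqrt]
    exact hN100
  have hMM : M * M ≤ N := Nat.sqrt_le N
  have hMN : 10 * (M : ℝ) ≤ N := by
    have : 10 * M ≤ M * M := Nat.mul_le_mul_right M hM10
    exact_mod_cast this.trans hMM
  have h2 := Chebyshev.theta_le_log4_mul_x (Nat.cast_nonneg M)
  have hlog4 : Real.log 4 < 1.4 := by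
    have : Real.log 4 = 2 * Real.log 2 := by
      rw [show (4 : ℝ) = 2 ^ 2 by norm_num, Real.log_pow]; norm_num
    rw [this]
    have := Real.log_two_lt_d9
    linarith
  have hM0 : (0 : ℝ) ≤ M := Nat.cast_nonneg M
  nlinarith

/-- The crux with non-degeneracy WEAKENED to its first clause (all linear coefficients non-zero). -/
def RelativeDimOneWithoutNonproportional : Prop :=
  ∀ (t L : ℕ), 1 ≤ t → ∀ ε : ℝ, 0 < ε → ∃ N₀ : ℕ, ∀ N : ℕ, N₀ ≤ N →
    ∀ Ψ : Fin t → AffLinForm 1, (∀ i, (Ψ i).coeff ≠ 0) → affLinSize Ψ N ≤ L →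
      ∀ K : Set (Fin 1 → ℝ), Convex ℝ K → K ⊆ realBox 1 N → Concl ε N Ψ K

/-- Sanity: the variant is the crux minus the pairwise clause (it implies the crux). -/
theorem relativeDimOneWithoutNonproportional_imp :
    RelativeDimOneWithoutNonproportional → RelativeDimOne := by
  intro h t L ht ε hε
  obtain ⟨N₀, hN₀⟩ := h t L ht ε hε
  exact ⟨N₀, fun N hN Ψ hΨ hL K hK hKN => hN₀ N hN Ψ hΨ.1 hL K hK hKN⟩

/-- **The pairwise (non-proportionality) clause is load-bearing.** Witness: `t = 2`, `Ψ = (n, n)`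
(`‖Ψ‖_N = 2`), `K = [1, N]`: `S = Σ_{n ≤ N} Λ(n)² ≥ ⅜ N log N` while the main term is `(N − 1)·c` for the
FIXED real `c = 𝔖(n,n)` (a `limUnder` of the divergent `∏_{p≤x} p/(p−1)`, value irrelevant): at `ε = 1`,
`|S − (N−1)c| ≤ (N−1)c + N` forces `⅜ log N ≤ 2|c| + 1`, false for `log N > 8|c| + 4`. -/
theorem relativeDimOne_false_without_nonproportional : ¬ RelativeDimOneWithoutNonproportional := by
  intro h
  obtain ⟨N₀, hN₀⟩ := h 2 2 (by norm_num) 1 one_pos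
  obtain ⟨N₁, hN₁⟩ := eventually_theta_sub_theta_sqrt_ge
  set c : ℝ := singularProduct rep with hc
  set N : ℕ := max (max N₀ N₁) (⌈Real.exp (8 * |c| + 4)⌉₊ + 1) with hNdef
  have hNN₀ : N₀ ≤ N := (le_max_left _ _).trans (le_max_left _ _)
  have hNN₁ : N₁ ≤ N := (le_max_right _ _).trans (le_max_left _ _)
  have hNexp : Real.exp (8 * |c| + 4) < N := by
    have h1 : ((⌈Real.exp (8 * |c| + 4)⌉₊ + 1 : ℕ) : ℝ) ≤ N := by exact_mod_cast le_max_right _ _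
    push_cast at h1
    linarith [Nat.le_ceil (Real.exp (8 * |c| + 4))]
  have hlogN : 8 * |c| + 4 < Real.log N := by
    rw [← Real.log_exp (8 * |c| + 4)]
    exact Real.log_lt_log (Real.exp_pos _) hNexp
  have hN1 : 1 ≤ N := le_trans (by omega) (le_max_right _ _)
  have hN1r : (1 : ℝ) ≤ N := by exact_mod_cast hN1
  have key := hN₀ N hNN₀ rep rep_coeff_ne_zero (by rw [affLinSize_rep]; norm_num) (seg 1 N)
    (convex_seg _ _)
    (seg_subset_realBox (by linarith) le_rfl)
  unfold Concl at key
  rw [archFactor_rep_seg hN1] at key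
  have hS := vonMangoldtSum_rep_ge hN1
  have hθ := hN₁ N hNN₁
  set S := vonMangoldtSum rep (seg 1 N) N with hSdef
  -- from `key`: `S ≤ 2 (N-1) c + N ≤ (2|c| + 1) N`
  have hup : S ≤ (2 * |c| + 1) * N := by
    have h1 := (abs_le.mp key).2
    have h2 : ((N : ℝ) - 1) * c ≤ N * |c| := by
      have := le_abs_self c
      have h3 : ((N : ℝ) - 1) * c ≤ ((N : ℝ) - 1) * |c| :=
        mul_le_mul_of_nonneg_left this (by linarith)
      nlinarith [abs_nonneg c]
    nlinarith
  -- from `hS`, `hθ`: `S ≥ (3/8) N log N`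
  have hlogN0 : 0 ≤ Real.log N := Real.log_nonneg hN1r
  have hlow : 3 / 8 * (N : ℝ) * Real.log N ≤ S := by nlinarith
  -- contradiction with `log N > 8|c| + 4`
  have hN0 : (0 : ℝ) < N := by linarith
  nlinarith [abs_nonneg c]

/-! ## §B3 (contrast to B2) Uniformity of `N₀` in `t` is AUTOMATIC: `‖Ψ‖_N ≥ t` -/

/-- A non-degenerate `d = 1` system of `t` forms has size `‖Ψ‖_N ≥ t` (each `|ψ̇ᵢ(e₀)| ≥ 1`). -/
theorem card_le_affLinSize {t : ℕ} {Ψ : Fin t → AffLinForm 1} (hΨ : IsNondegenerateSystem Ψ) (N : ℝ) :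
    (t : ℝ) ≤ affLinSize Ψ N := by
  unfold affLinSize
  have h1 : ∀ i, (1 : ℝ) ≤ ∑ j, |((Ψ i).coeff j : ℝ)| := by
    intro i
    rw [Fin.sum_univ_one]
    have hne : (Ψ i).coeff 0 ≠ 0 := by
      intro h0
      refine hΨ.1 i (funext fun j => ?_)
      rw [Fin.fin_one_eq_zero j]
      simpa using h0
    have : (1 : ℤ) ≤ |(Ψ i).coeff 0| := Int.one_le_abs hne
    rw [← Int.cast_abs]
    exact_mod_cast this
  have h3 : 0 ≤ ∑ i, |((Ψ i).const : ℝ) / N| := Finset.sum_nonneg fun i _ => abs_nonneg _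
  calc (t : ℝ) = ∑ _i : Fin t, (1 : ℝ) := by simp
    _ ≤ ∑ i, ∑ j, |((Ψ i).coeff j : ℝ)| := Finset.sum_le_sum fun i _ => h1 i
    _ ≤ _ := le_add_of_nonneg_right h3

/-- The crux with `N₀` chosen BEFORE `t` (uniformity in the number of forms). -/
def RelativeDimOneUniformInT : Prop :=
  ∀ L : ℕ, ∀ ε : ℝ, 0 < ε → ∃ N₀ : ℕ, ∀ t : ℕ, 1 ≤ t → ∀ N : ℕ, N₀ ≤ N →
    ∀ Ψ : Fin t → AffLinForm 1, IsNondegenerateSystem Ψ → affLinSize Ψ N ≤ L →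
      ∀ K : Set (Fin 1 → ℝ), Convex ℝ K → K ⊆ realBox 1 N → Concl ε N Ψ K

/-- **Uniformity in `t` costs nothing** (contrast: uniformity in `L` is false, B2): since `‖Ψ‖_N ≥ t`,
only `t ≤ L` is inhabited, and `N₀(L, ε) := max_{t ≤ L} N₀(t, L, ε)` serves all `t`. So the crux is
EQUIVALENT to its `t`-uniform form; the parameter `t` in the threshold is redundant. -/
theorem relativeDimOneUniformInT_iff : RelativeDimOneUniformInT ↔ RelativeDimOne := by
  constructor
  · intro h t L ht ε hε
    obtain ⟨N₀, hN₀⟩ := h L ε hε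
    exact ⟨N₀, hN₀ t ht⟩
  · intro h L ε hε
    choose N₀ hN₀ using fun t : ℕ => h (t + 1) L (Nat.le_add_left 1 t) ε hε
    refine ⟨(Finset.range L).sup N₀, fun t ht N hN Ψ hΨ hL K hK hKN => ?_⟩
    obtain ⟨t, rfl⟩ : ∃ t', t = t' + 1 := ⟨t - 1, by omega⟩
    by_cases htL : t < L
    · exact hN₀ t N ((Finset.le_sup (Finset.mem_range.mpr htL)).trans hN) Ψ hΨ hL K hK hKN
    · exfalso
      have h1 := card_le_affLinSize hΨ N
      have h2 : (L : ℝ) < (t + 1 : ℕ) := by exact_mod_cast (show L < t + 1 by omega)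
      linarith

end Summit.Parity.GeneralizedHardyLittlewood.Theorems.RelativeDimOne.Negative
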